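import Literature.Analysis.FluidPDE.DoeringFoias
import Literature.Analysis.FluidPDE.LerayHopfSpectralMeasurability
import Literature.Analysis.FluidPDE.StatisticalSolutionProofs
import Literature.Analysis.FunctionSpaces.TorusVectorParseval
import HarnessLib

/-!
# Doering–Foias a-priori bounds: proof of the power-balance inequality `ε ≤ ⟨f·u⟩`

Sibling proof file of `Literature.Analysis.FluidPDE.DoeringFoias`. It discharges the named fact
`Literature.Analysis.FluidPDE.DoeringFoias2002_dissipation_le_power` (Cheskidov–Doering–Petrov
2007, eq. (11) and the sentence following it: for weak solutions "the relation in (11) is only an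
inequality, i.e. `ε ≤ ⟨f·u⟩`", with `lim sup` long-time averages, "fully applicable to weak
solutions"): for every viscosity `ν > 0`, every square-integrable mean-zero steady force `f` on
`T³` and every global Leray–Hopf solution `u`, `meanDissipation ν u ≤ meanPower f u`.

## The argument

Write `D(t) = ν‖∇u(t)‖₂²` (spectral, `Torus.eGradNormSq`), `P(t) = ∫ ⟪f, u(t)⟫`,
`E₀ = ½‖u₀‖₂²` and `⟨g⟩_T = T⁻¹∫₀ᵀ g` (`timeMean`).

1. `∫₀ᵀ D = ν (∫⁻_{(0,T)} ‖∇u‖₂²).toReal`: the integrand is a.e.-measurable in time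
   (`Torus.IsLerayHopfOn.aemeasurable_eGradNormSq`) with finite lower integral
   (`Torus.IsLerayHopfOn.lintegral_eGradNormSq_lt_top`, from `u ∈ L²(0,T;H¹)`).
2. The Leray–Hopf energy inequality from `0` at `t = T` then reads `∫₀ᵀ D ≤ E₀ + ∫₀ᵀ P`
   (dropping `½‖u(T)‖² ≥ 0`), i.e. `⟨D⟩_T ≤ E₀/T + ⟨P⟩_T`.
3. To pass to `lim sup` (in `ℝ`, where `Filter.limsup` of an unbounded family is a junk value) one
   needs the running means `⟨P⟩_T` to be bounded. This follows from the spectral Poincaré–Young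
   inequality `∫ ⟪f, v⟫ ≤ ‖f‖₂²/(2b) + (b/2)(4π²)⁻¹‖∇v‖₂²` for mean-zero `f` (the zero mode of `f`
   vanishes and `|k| ≥ 1` at the other modes; Parseval): with `b = 4π²ν` it gives `|P| ≤ A + D/2`
   a.e. in time, `A = ‖f‖₂²/(8π²ν)`, whence `∫₀ᵀ D ≤ 2E₀ + 2AT` and `|∫₀ᵀ P| ≤ E₀ + 2AT`.
4. `limsup ⟨D⟩ ≤ limsup (E₀/T + ⟨P⟩) ≤ lim E₀/T + limsup ⟨P⟩ = ⟨f·u⟩`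
   (`Filter.limsup_le_limsup`, `limsup_add_le`).

This is the standard derivation (Doering–Foias 2002, §2 — the source only quotes the result); no
mean-zero hypothesis on the datum is used, in accordance with the vendored statement.

## References

* A. Cheskidov, C. R. Doering, N. P. Petrov, *Energy dissipation in fractal-forced flow*,
  J. Math. Phys. 48 (2007) 065208, arXiv:physics/0607280, §II eq. (11) and the remark following it.
* C. R. Doering, C. Foias, *Energy dissipation in body-forced turbulence*, J. Fluid Mech. 467
  (2002), 289–306, §2.
-/

open MeasureTheory Filter Set UnitAddTorus
open scoped ENNReal NNReal RealInnerProductSpace Topology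

noncomputable section

namespace Literature.Analysis.FluidPDE

variable {d : Type*} [Fintype d]

/-! ### A spectral Poincaré–Young bound on the injected power -/

section PowerBound

/-- The zero Fourier mode of a mean-zero real vector field vanishes:
`𝓕(complexify ∘ f)(0) = complexify (∫ f) = 0` (Grafakos, §3.1: `f̂(0)` is the mean). [folklore] -/
theorem mFourierCoeff_complexify_zero_of_hasZeroMean {f : UnitAddTorus d → EuclideanSpace ℝ d}
    (hf0 : FunctionSpaces.Torus.HasZeroMean f) :
    mFourierCoeff (FunctionSpaces.EuclideanSpace.complexify ∘ f) 0 = 0 := by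
  have h0 : ∫ x, f x = 0 := hf0
  rw [FunctionSpaces.Torus.mFourierCoeff_eq_integral_volume]
  simp only [neg_zero, mFourier_zero, ContinuousMap.one_apply, one_smul, Function.comp_apply]
  rw [FunctionSpaces.EuclideanSpace.complexify.integral_comp_comm f, h0, map_zero]

/-- Young's inequality for the real part of a Hermitian inner product:
`Re ⟪a, c⟫ ≤ ‖a‖‖c‖ ≤ b⁻¹/2 ‖a‖² + b/2 ‖c‖²` for `b > 0`. [folklore] -/
theorem re_inner_le_young (a c : EuclideanSpace ℂ d) {b : ℝ} (hb : 0 < b) :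
    (inner ℂ a c).re ≤ b⁻¹ / 2 * ‖a‖ ^ 2 + b / 2 * ‖c‖ ^ 2 := by
  have h1 : (inner ℂ a c).re ≤ ‖a‖ * ‖c‖ :=
    (Complex.re_le_norm _).trans (norm_inner_le_norm a c)
  have hbc : b * b⁻¹ = 1 := mul_inv_cancel₀ hb.ne'
  have key : b⁻¹ / 2 * ‖a‖ ^ 2 + b / 2 * ‖c‖ ^ 2 - ‖a‖ * ‖c‖ = b⁻¹ / 2 * (‖a‖ - b * ‖c‖) ^ 2 := by
    have : b⁻¹ / 2 * (‖a‖ - b * ‖c‖) ^ 2 =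
        b⁻¹ / 2 * ‖a‖ ^ 2 - (b * b⁻¹) * (‖a‖ * ‖c‖) + (b * b⁻¹) * (b / 2 * ‖c‖ ^ 2) := by ring
    rw [this, hbc]; ring
  have h3 : 0 ≤ b⁻¹ / 2 * (‖a‖ - b * ‖c‖) ^ 2 := by positivity
  linarith

/-- **Spectral Poincaré–Young bound on the power injected by a mean-zero force.** For
`f, v ∈ L²(T^d; ℝ^d)` with `∫ f = 0`, finite spectral dissipation `‖∇v‖₂² < ∞`
(`Torus.eGradNormSq`), and every `b > 0`,
`∫ ⟪f, v⟫ ≤ b⁻¹/2 ‖f‖₂² + b/2 · (4π²)⁻¹ ‖∇v‖₂²`.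
Proof: Parseval in polarised form `∫ ⟪f, v⟫ = ∑ₖ Re ⟪f̂ₖ, v̂ₖ⟫`
(`Torus.hasSum_re_inner_mFourierCoeff_complexify`), the zero mode drops out (`f̂₀ = 0`), Young's
inequality termwise and `|k|² ≥ 1` for `k ≠ 0`, so that `∑_{k≠0} ‖v̂ₖ‖² ≤ ∑ₖ |k|²‖v̂ₖ‖² =
(4π²)⁻¹‖∇v‖₂²` (`Torus.eGradNormSq_eq_tsum`) — the Poincaré inequality on the unit torus with
first eigenvalue `λ₁ = 4π²` (the inequality behind Cheskidov–Doering–Petrov 2007, eq. (12),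
`ε ≥ 4π²νU²/ℓ²`). Optimising in `b` gives `|∫ ⟪f, v⟫| ≤ (2π)⁻¹ ‖f‖₂ ‖∇v‖₂`. [folklore] -/
theorem integral_inner_le_of_hasZeroMean {f v : UnitAddTorus d → EuclideanSpace ℝ d}
    (hf : MemLp f 2 volume) (hf0 : FunctionSpaces.Torus.HasZeroMean f) (hv : MemLp v 2 volume)
    (hfin : FunctionSpaces.Torus.eGradNormSq v ≠ ∞) {b : ℝ} (hb : 0 < b) :
    ∫ x, ⟪f x, v x⟫ ≤ b⁻¹ / 2 * (∫ x, ‖f x‖ ^ 2) +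
      b / 2 * ((4 * Real.pi ^ 2)⁻¹ * (FunctionSpaces.Torus.eGradNormSq v).toReal) := by
  set F : (d → ℤ) → EuclideanSpace ℂ d :=
    fun k => mFourierCoeff (FunctionSpaces.EuclideanSpace.complexify ∘ f) k
  set V : (d → ℤ) → EuclideanSpace ℂ d :=
    fun k => mFourierCoeff (FunctionSpaces.EuclideanSpace.complexify ∘ v) k
  have h1 : HasSum (fun k => (inner ℂ (F k) (V k)).re) (∫ x, ⟪f x, v x⟫) :=
    FunctionSpaces.Torus.hasSum_re_inner_mFourierCoeff_complexify hf hv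
  have h2 : HasSum (fun k => ‖F k‖ ^ 2) (∫ x, ‖f x‖ ^ 2) :=
    FunctionSpaces.Torus.hasSum_sq_norm_mFourierCoeff_complexify hf
  -- the spectral dissipation as a real series
  set S : ℝ≥0∞ := ∑' k : d → ℤ,
    ENNReal.ofReal (FunctionSpaces.Torus.freqNormSq k) * ‖V k‖ₑ ^ 2
  have hgrad : FunctionSpaces.Torus.eGradNormSq v = ENNReal.ofReal (4 * Real.pi ^ 2) * S :=
    FunctionSpaces.Torus.eGradNormSq_eq_tsum v
  have hpi : 0 < 4 * Real.pi ^ 2 := by positivity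
  have hS_ne : S ≠ ∞ := by
    intro h
    apply hfin
    rw [hgrad, h, ENNReal.mul_top]
    exact (ENNReal.ofReal_pos.2 hpi).ne'
  have hterm_ne : ∀ k, ENNReal.ofReal (FunctionSpaces.Torus.freqNormSq k) * ‖V k‖ₑ ^ 2 ≠ ∞ :=
    fun k => ENNReal.ne_top_of_tsum_ne_top hS_ne k
  have h3 : HasSum (fun k => FunctionSpaces.Torus.freqNormSq k * ‖V k‖ ^ 2) S.toReal := by
    have h := (ENNReal.summable_toReal hS_ne).hasSum_iff.2 (ENNReal.tsum_toReal_eq hterm_ne).symm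
    have hfun : (fun k => (ENNReal.ofReal (FunctionSpaces.Torus.freqNormSq k) *
        ‖V k‖ₑ ^ 2).toReal) = fun k => FunctionSpaces.Torus.freqNormSq k * ‖V k‖ ^ 2 := by
      funext k
      rw [ENNReal.toReal_mul, ENNReal.toReal_ofReal (FunctionSpaces.Torus.freqNormSq_nonneg k),
        ENNReal.toReal_pow, toReal_enorm]
    rwa [hfun] at h
  -- termwise comparison
  have hle : ∀ k, (inner ℂ (F k) (V k)).re ≤
      b⁻¹ / 2 * ‖F k‖ ^ 2 + b / 2 * (FunctionSpaces.Torus.freqNormSq k * ‖V k‖ ^ 2) := by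
    intro k
    by_cases hk : k = 0
    · subst hk
      have hF0 : F 0 = 0 := mFourierCoeff_complexify_zero_of_hasZeroMean hf0
      simp [hF0, FunctionSpaces.Torus.freqNormSq_zero]
    · calc (inner ℂ (F k) (V k)).re ≤ b⁻¹ / 2 * ‖F k‖ ^ 2 + b / 2 * ‖V k‖ ^ 2 :=
            re_inner_le_young _ _ hb
        _ ≤ b⁻¹ / 2 * ‖F k‖ ^ 2 + b / 2 * (FunctionSpaces.Torus.freqNormSq k * ‖V k‖ ^ 2) := by
            gcongr
            exact le_mul_of_one_le_left (sq_nonneg _) (Torus.one_le_freqNormSq hk)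
  have hsum := hasSum_le hle h1 ((h2.mul_left (b⁻¹ / 2)).add (h3.mul_left (b / 2)))
  have hSr : S.toReal = (4 * Real.pi ^ 2)⁻¹ * (FunctionSpaces.Torus.eGradNormSq v).toReal := by
    rw [hgrad, ENNReal.toReal_mul, ENNReal.toReal_ofReal hpi.le]
    field_simp
  rw [← hSr]
  exact hsum

/-- The two-sided form used for Leray–Hopf solutions: for `ν > 0`, a mean-zero `f ∈ L²`, and
`v ∈ L²` with `‖∇v‖₂² < ∞`,
`|∫ ⟪f, v⟫| ≤ ‖f‖₂²/(8π²ν) + (ν/2) ‖∇v‖₂²`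
(`integral_inner_le_of_hasZeroMean` with `b = 4π²ν`, applied to `f` and `-f`). [folklore] -/
theorem abs_integral_inner_le_of_hasZeroMean {f v : UnitAddTorus d → EuclideanSpace ℝ d}
    (hf : MemLp f 2 volume) (hf0 : FunctionSpaces.Torus.HasZeroMean f) (hv : MemLp v 2 volume)
    (hfin : FunctionSpaces.Torus.eGradNormSq v ≠ ∞) {ν : ℝ} (hν : 0 < ν) :
    |∫ x, ⟪f x, v x⟫| ≤ (4 * Real.pi ^ 2 * ν)⁻¹ / 2 * (∫ x, ‖f x‖ ^ 2) +
      ν / 2 * (FunctionSpaces.Torus.eGradNormSq v).toReal := by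
  have hpi : 0 < 4 * Real.pi ^ 2 := by positivity
  have hb : 0 < 4 * Real.pi ^ 2 * ν := mul_pos hpi hν
  have hid : 4 * Real.pi ^ 2 * ν / 2 * ((4 * Real.pi ^ 2)⁻¹ *
      (FunctionSpaces.Torus.eGradNormSq v).toReal) =
        ν / 2 * (FunctionSpaces.Torus.eGradNormSq v).toReal := by
    field_simp
  -- upper bound for `f`
  have hup := integral_inner_le_of_hasZeroMean hf hf0 hv hfin hb
  rw [hid] at hup
  -- upper bound for `-f`
  have hf0' : FunctionSpaces.Torus.HasZeroMean (-f) := by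
    have h0 : ∫ x, f x = 0 := hf0
    show ∫ x, (-f) x = 0
    simp only [Pi.neg_apply, integral_neg, h0, neg_zero]
  have hlow := integral_inner_le_of_hasZeroMean hf.neg hf0' hv hfin hb
  rw [hid] at hlow
  have hneg : ∫ x, ⟪(-f) x, v x⟫ = -∫ x, ⟪f x, v x⟫ := by
    simp only [Pi.neg_apply, inner_neg_left, integral_neg]
  have hnorm : ∫ x, ‖(-f) x‖ ^ 2 = ∫ x, ‖f x‖ ^ 2 := by simp only [Pi.neg_apply, norm_neg]
  rw [hneg, hnorm] at hlow
  exact abs_le.2 ⟨by linarith, hup⟩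

end PowerBound

/-! ### Time integrals of dissipation and power along a global Leray–Hopf solution -/

section TimeIntegrals

variable [DecidableEq d] {ν : ℝ} {f : UnitAddTorus d → EuclideanSpace ℝ d}
  {u₀ : UnitAddTorus d → EuclideanSpace ℝ d} {u : ℝ → UnitAddTorus d → EuclideanSpace ℝ d}

/-- **The time integral of the spectral dissipation is honest.** Along a Leray–Hopf solution on
`[0, T)`, `T > 0`, the Bochner integral `∫₀ᵀ ν‖∇u(t)‖₂² dt` of the real-valued integrand of
`meanDissipation` equals `ν (∫⁻_{(0,T)} ‖∇u‖₂²).toReal`, the dissipation term of the energy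
inequality, and the integrand is interval integrable (a.e.-measurable with finite lower integral,
`Torus.IsLerayHopfOn.aemeasurable_eGradNormSq` / `…lintegral_eGradNormSq_lt_top`). [folklore] -/
theorem Torus.IsLerayHopfOn.intervalIntegral_dissipation_eq {T : ℝ}
    {g : ℝ → UnitAddTorus d → EuclideanSpace ℝ d} (hu : Torus.IsLerayHopfOn T ν g u₀ u)
    (hT : 0 < T) :
    IntervalIntegrable (fun t => ν * (FunctionSpaces.Torus.eGradNormSq (u t)).toReal) volume 0 T ∧
      ∫ t in 0..T, ν * (FunctionSpaces.Torus.eGradNormSq (u t)).toReal =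
        ν * (∫⁻ t in Ioo 0 T, FunctionSpaces.Torus.eGradNormSq (u t)).toReal := by
  have hmeas := hu.aemeasurable_eGradNormSq
  have hfin := hu.lintegral_eGradNormSq_lt_top
  refine ⟨?_, ?_⟩
  · rw [intervalIntegrable_iff_integrableOn_Ioc_of_le hT.le, integrableOn_Ioc_iff_integrableOn_Ioo]
    exact (integrable_toReal_of_lintegral_ne_top hmeas hfin.ne).const_mul ν
  · rw [intervalIntegral.integral_of_le hT.le, integral_Ioc_eq_integral_Ioo, integral_const_mul,
      integral_toReal hmeas (ae_lt_top' hmeas hfin.ne)]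

/-- **Dissipation is paid for by the initial energy and the injected power**: along a Leray–Hopf
solution on `[0, T)` with steady force `f`, `∫₀ᵀ ν‖∇u‖₂² ≤ ½‖u₀‖₂² + ∫₀ᵀ ∫ ⟪f, u⟫` (the energy
inequality from `0` at `t = T`, `Torus.IsLerayHopfOn.energy_ineq_zero`, dropping `½‖u(T)‖₂² ≥ 0`;
Leray 1934, (5.2); Doering–Foias 2002, §2). [folklore] -/
theorem Torus.IsLerayHopfOn.intervalIntegral_dissipation_le {T : ℝ}
    (hu : Torus.IsLerayHopfOn T ν (fun _ => f) u₀ u) (hT : 0 < T) :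
    ∫ t in 0..T, ν * (FunctionSpaces.Torus.eGradNormSq (u t)).toReal ≤
      FunctionSpaces.Torus.kineticEnergy u₀ + ∫ t in 0..T, ∫ x, ⟪f x, u t x⟫ := by
  have hE := hu.energy_ineq_zero T ⟨hT.le, le_rfl⟩
  rw [(hu.intervalIntegral_dissipation_eq hT).2]
  linarith [FunctionSpaces.Torus.kineticEnergy_nonneg (u T)]

/-- **Pointwise-in-time bound on the injected power**: along a Leray–Hopf solution on `[0, T)`
with a steady mean-zero force `f ∈ L²` and `ν > 0`, for a.e. `t ∈ (0, T]`,
`|∫ ⟪f, u(t)⟫| ≤ ‖f‖₂²/(8π²ν) + (ν/2)‖∇u(t)‖₂²` (`abs_integral_inner_le_of_hasZeroMean` at the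
a.e. times where `‖∇u(t)‖₂² < ∞`). [folklore] -/
theorem Torus.IsLerayHopfOn.ae_abs_power_le {T : ℝ} {g : ℝ → UnitAddTorus d → EuclideanSpace ℝ d}
    (hu : Torus.IsLerayHopfOn T ν g u₀ u) (hν : 0 < ν) (hf : MemLp f 2 volume)
    (hf0 : FunctionSpaces.Torus.HasZeroMean f) :
    ∀ᵐ t ∂(volume.restrict (Ioc 0 T)),
      |∫ x, ⟪f x, u t x⟫| ≤ (4 * Real.pi ^ 2 * ν)⁻¹ / 2 * (∫ x, ‖f x‖ ^ 2) +
        ν / 2 * (FunctionSpaces.Torus.eGradNormSq (u t)).toReal := by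
  have hae : ∀ᵐ t ∂(volume.restrict (Ioo 0 T)), FunctionSpaces.Torus.eGradNormSq (u t) < ∞ :=
    ae_lt_top' hu.aemeasurable_eGradNormSq hu.lintegral_eGradNormSq_lt_top.ne
  rw [← Measure.restrict_congr_set (Ioo_ae_eq_Ioc (μ := (volume : Measure ℝ)) (a := 0) (b := T))]
  filter_upwards [hae, ae_restrict_mem measurableSet_Ioo] with t ht htmem
  exact abs_integral_inner_le_of_hasZeroMean hf hf0 (hu.memLp t (Ioo_subset_Icc_self htmem))
    ht.ne hν

/-- **The injected power is integrable in time** along a Leray–Hopf solution with steady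
mean-zero force `f ∈ L²`, `ν > 0`: `t ↦ ∫ ⟪f, u(t)⟫` is continuous on `(0, T]` (weak `L²`
continuity, field `weak_continuous`), hence measurable, and dominated by the integrable
`‖f‖₂²/(8π²ν) + (ν/2)‖∇u(t)‖₂²` (`Torus.IsLerayHopfOn.ae_abs_power_le`). [folklore] -/
theorem Torus.IsLerayHopfOn.intervalIntegrable_power {T : ℝ}
    (hu : Torus.IsLerayHopfOn T ν (fun _ => f) u₀ u) (hT : 0 < T) (hν : 0 < ν)
    (hf : MemLp f 2 volume) (hf0 : FunctionSpaces.Torus.HasZeroMean f) :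
    IntervalIntegrable (fun t => ∫ x, ⟪f x, u t x⟫) volume 0 T := by
  rw [intervalIntegrable_iff_integrableOn_Ioc_of_le hT.le]
  have hcont : ContinuousOn (fun t => ∫ x, ⟪f x, u t x⟫) (Ioc 0 T) := by
    refine (hu.weak_continuous f hf).1.congr fun t _ => ?_
    simp only [real_inner_comm (f _)]
  have hmeasP : AEStronglyMeasurable (fun t => ∫ x, ⟪f x, u t x⟫) (volume.restrict (Ioc 0 T)) :=
    hcont.aestronglyMeasurable measurableSet_Ioc
  have hD : IntegrableOn (fun t => ν * (FunctionSpaces.Torus.eGradNormSq (u t)).toReal)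
      (Ioc 0 T) :=
    (intervalIntegrable_iff_integrableOn_Ioc_of_le hT.le).1
      (hu.intervalIntegral_dissipation_eq hT).1
  have hdom : Integrable (fun t => (4 * Real.pi ^ 2 * ν)⁻¹ / 2 * (∫ x, ‖f x‖ ^ 2) +
      ν / 2 * (FunctionSpaces.Torus.eGradNormSq (u t)).toReal) (volume.restrict (Ioc 0 T)) := by
    refine Integrable.add (integrable_const _) ?_
    have : (fun t => ν / 2 * (FunctionSpaces.Torus.eGradNormSq (u t)).toReal) =
        fun t => 2⁻¹ * (ν * (FunctionSpaces.Torus.eGradNormSq (u t)).toReal) := by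
      funext t; ring
    rw [this]
    exact hD.const_mul 2⁻¹
  refine hdom.mono' hmeasP ?_
  filter_upwards [hu.ae_abs_power_le hν hf hf0] with t ht using (Real.norm_eq_abs _).trans_le ht

/-- **A-priori bounds on the time integrals**: along a Leray–Hopf solution on `[0, T)`, `T > 0`,
with steady mean-zero force `f ∈ L²` and `ν > 0`, writing `A = ‖f‖₂²/(8π²ν)`, `E₀ = ½‖u₀‖₂²`:
`∫₀ᵀ ν‖∇u‖₂² ≤ 2E₀ + 2AT` and `|∫₀ᵀ ∫⟪f, u⟫| ≤ E₀ + 2AT`. Integrating the pointwise bound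
`Torus.IsLerayHopfOn.ae_abs_power_le` gives `±∫₀ᵀ ∫⟪f, u⟫ ≤ AT + ½∫₀ᵀ ν‖∇u‖₂²`, which is combined
with `∫₀ᵀ ν‖∇u‖₂² ≤ E₀ + ∫₀ᵀ ∫⟪f, u⟫` (`…intervalIntegral_dissipation_le`) (Doering–Foias 2002,
§2: the running means of dissipation and power are bounded uniformly in `T ≥ 1`). [folklore] -/
theorem Torus.IsLerayHopfOn.intervalIntegral_power_bounds {T : ℝ}
    (hu : Torus.IsLerayHopfOn T ν (fun _ => f) u₀ u) (hT : 0 < T) (hν : 0 < ν)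
    (hf : MemLp f 2 volume) (hf0 : FunctionSpaces.Torus.HasZeroMean f) :
    (∫ t in 0..T, ν * (FunctionSpaces.Torus.eGradNormSq (u t)).toReal ≤
        2 * FunctionSpaces.Torus.kineticEnergy u₀ +
          2 * ((4 * Real.pi ^ 2 * ν)⁻¹ / 2 * ∫ x, ‖f x‖ ^ 2) * T) ∧
      |∫ t in 0..T, ∫ x, ⟪f x, u t x⟫| ≤ FunctionSpaces.Torus.kineticEnergy u₀ +
          2 * ((4 * Real.pi ^ 2 * ν)⁻¹ / 2 * ∫ x, ‖f x‖ ^ 2) * T := by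
  have hDI := (intervalIntegrable_iff_integrableOn_Ioc_of_le hT.le).1
    (hu.intervalIntegral_dissipation_eq hT).1
  have hPI := (intervalIntegrable_iff_integrableOn_Ioc_of_le hT.le).1
    (hu.intervalIntegrable_power hT hν hf hf0)
  have hae := hu.ae_abs_power_le hν hf hf0
  have h3 := hu.intervalIntegral_dissipation_le hT
  have hE0 := FunctionSpaces.Torus.kineticEnergy_nonneg u₀
  rw [intervalIntegral.integral_of_le hT.le, intervalIntegral.integral_of_le hT.le] at h3 ⊢
  set A : ℝ := (4 * Real.pi ^ 2 * ν)⁻¹ / 2 * ∫ x, ‖f x‖ ^ 2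
  set D : ℝ → ℝ := fun t => ν * (FunctionSpaces.Torus.eGradNormSq (u t)).toReal with hD
  set P : ℝ → ℝ := fun t => ∫ x, ⟪f x, u t x⟫
  -- integrate the pointwise bounds `±P ≤ A + D/2` over `(0, T]`
  have hbound : ∀ᵐ t ∂(volume.restrict (Ioc 0 T)), P t ≤ A + 2⁻¹ * D t ∧ -P t ≤ A + 2⁻¹ * D t := by
    filter_upwards [hae] with t ht
    have h := abs_le.1 ht
    constructor
    · calc P t ≤ A + ν / 2 * (FunctionSpaces.Torus.eGradNormSq (u t)).toReal := h.2
        _ = A + 2⁻¹ * D t := by simp only [hD]; ring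
    · calc -P t ≤ A + ν / 2 * (FunctionSpaces.Torus.eGradNormSq (u t)).toReal := by linarith [h.1]
        _ = A + 2⁻¹ * D t := by simp only [hD]; ring
  have hRI : Integrable (fun t => A + 2⁻¹ * D t) (volume.restrict (Ioc 0 T)) :=
    (integrable_const A).add (hDI.const_mul 2⁻¹)
  have hR1 : ∫ _ in Ioc 0 T, A = A * T := by
    rw [setIntegral_const, Real.volume_real_Ioc_of_le hT.le, sub_zero, smul_eq_mul, mul_comm]
  have hR2 : ∫ t in Ioc 0 T, 2⁻¹ * D t = 2⁻¹ * ∫ t in Ioc 0 T, D t := integral_const_mul _ _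
  have hR : ∫ t in Ioc 0 T, (A + 2⁻¹ * D t) = A * T + 2⁻¹ * ∫ t in Ioc 0 T, D t := by
    rw [integral_add (integrable_const A) (hDI.const_mul 2⁻¹), hR1, hR2]
  have h1 : ∫ t in Ioc 0 T, P t ≤ A * T + 2⁻¹ * ∫ t in Ioc 0 T, D t := by
    rw [← hR]
    exact integral_mono_ae hPI hRI (hbound.mono fun t ht => ht.1)
  have h2 : -∫ t in Ioc 0 T, P t ≤ A * T + 2⁻¹ * ∫ t in Ioc 0 T, D t := by
    rw [← hR, ← integral_neg]
    exact integral_mono_ae hPI.neg hRI (hbound.mono fun t ht => ht.2)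
  exact ⟨by linarith, abs_le.2 ⟨by linarith, by linarith⟩⟩

end TimeIntegrals

/-! ### Discharge of `DoeringFoias2002_dissipation_le_power` -/

section Discharge

/-- **Power balance inequality `ε ≤ ⟨f·u⟩` for Leray–Hopf solutions** — discharge of the named
fact `DoeringFoias2002_dissipation_le_power` (Cheskidov–Doering–Petrov 2007, eq. (11) and the
sentence following it: for weak solutions the power balance `ε = ⟨f·u⟩` "is only an inequality,
i.e. `ε ≤ ⟨f·u⟩`", the long-time averages being `lim sup`s, with which "the estimates … are fully
applicable to weak solutions"; Doering–Foias 2002, §2). Proof: by the energy inequality from `0`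
the running means satisfy `⟨ν‖∇u‖₂²⟩_T ≤ ½‖u₀‖₂²/T + ⟨∫⟪f,u⟫⟩_T`
(`Torus.IsLerayHopfOn.intervalIntegral_dissipation_le`); both families of running means are
bounded for `T ≥ 1` (`Torus.IsLerayHopfOn.intervalIntegral_power_bounds`, from the spectral
Poincaré–Young bound `integral_inner_le_of_hasZeroMean`), so `Filter.limsup` is monotone and
subadditive along them (`Filter.limsup_le_limsup`, `limsup_add_le`) and
`½‖u₀‖₂²/T → 0`. [cite: CheskidovDoeringPetrov2006, eq. (11)] -/
theorem DoeringFoias2002_dissipation_le_power_holds : DoeringFoias2002_dissipation_le_power := by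
  intro ν hν f hf hf0 u₀ u hu
  set D : ℝ → ℝ := fun t => ν * (FunctionSpaces.Torus.eGradNormSq (u t)).toReal
  set P : ℝ → ℝ := fun t => ∫ x, ⟪f x, u t x⟫
  set E₀ : ℝ := FunctionSpaces.Torus.kineticEnergy u₀ with hE₀
  set A : ℝ := (4 * Real.pi ^ 2 * ν)⁻¹ / 2 * ∫ x, ‖f x‖ ^ 2 with hA
  have hE0 : 0 ≤ E₀ := FunctionSpaces.Torus.kineticEnergy_nonneg _
  -- the running-mean inequalities, for every `T > 0`
  have key : ∀ T, 0 < T →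
      timeMean D T ≤ E₀ * T⁻¹ + timeMean P T ∧ 0 ≤ timeMean D T ∧
        timeMean P T ≤ E₀ * T⁻¹ + 2 * A ∧ -(E₀ * T⁻¹) ≤ timeMean P T := by
    intro T hT
    have hLH := hu T hT
    obtain ⟨-, hPb⟩ := hLH.intervalIntegral_power_bounds hT hν hf hf0
    have hDP := hLH.intervalIntegral_dissipation_le hT
    have hDnn : 0 ≤ ∫ t in 0..T, D t := by
      rw [(hLH.intervalIntegral_dissipation_eq hT).2]
      exact mul_nonneg hν.le ENNReal.toReal_nonneg
    rw [← hE₀, ← hA] at hPb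
    rw [← hE₀] at hDP
    have hPabs := abs_le.1 hPb
    have hTi : 0 < T⁻¹ := inv_pos.2 hT
    have hTT : T⁻¹ * T = 1 := inv_mul_cancel₀ hT.ne'
    simp only [timeMean]
    refine ⟨?_, mul_nonneg hTi.le hDnn, ?_, ?_⟩
    · calc T⁻¹ * ∫ t in 0..T, D t ≤ T⁻¹ * (E₀ + ∫ t in 0..T, P t) :=
            mul_le_mul_of_nonneg_left hDP hTi.le
        _ = E₀ * T⁻¹ + T⁻¹ * ∫ t in 0..T, P t := by ring
    · calc T⁻¹ * ∫ t in 0..T, P t ≤ T⁻¹ * (E₀ + 2 * A * T) :=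
            mul_le_mul_of_nonneg_left hPabs.2 hTi.le
        _ = E₀ * T⁻¹ + 2 * A * (T⁻¹ * T) := by ring
        _ = E₀ * T⁻¹ + 2 * A := by rw [hTT, mul_one]
    · calc -(E₀ * T⁻¹) = T⁻¹ * (-E₀) := by ring
        _ ≤ T⁻¹ * ∫ t in 0..T, P t :=
            mul_le_mul_of_nonneg_left (by linarith [hDP, hDnn]) hTi.le
  -- boundedness of the running means along `atTop`
  have hT1 : ∀ᶠ T : ℝ in atTop, 1 ≤ T := eventually_ge_atTop 1
  have hinv : ∀ T : ℝ, 1 ≤ T → E₀ * T⁻¹ ≤ E₀ := fun T hT =>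
    (mul_le_mul_of_nonneg_left (inv_le_one_of_one_le₀ hT) hE0).trans_eq (mul_one _)
  have hPle : ∀ᶠ T in atTop, timeMean P T ≤ E₀ + 2 * A := by
    filter_upwards [hT1] with T hT
    exact ((key T (by linarith)).2.2.1).trans (by linarith [hinv T hT])
  have hPge : ∀ᶠ T in atTop, -E₀ ≤ timeMean P T := by
    filter_upwards [hT1] with T hT
    exact le_trans (by linarith [hinv T hT]) (key T (by linarith)).2.2.2
  have hDge : ∀ᶠ T in atTop, 0 ≤ timeMean D T := by
    filter_upwards [hT1] with T hT using (key T (by linarith)).2.1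
  have hDle : ∀ᶠ T in atTop, timeMean D T ≤ E₀ * T⁻¹ + timeMean P T := by
    filter_upwards [hT1] with T hT using (key T (by linarith)).1
  have hK : Tendsto (fun T : ℝ => E₀ * T⁻¹) atTop (𝓝 0) := by
    simpa using tendsto_inv_atTop_zero.const_mul E₀
  have hPbdd : IsBoundedUnder (· ≤ ·) atTop (timeMean P) := isBoundedUnder_of_eventually_le hPle
  -- pass to `lim sup` (monotone and subadditive along (co)bounded families)
  calc meanDissipation ν u = limsup (timeMean D) atTop := rfl
    _ ≤ limsup ((fun T : ℝ => E₀ * T⁻¹) + timeMean P) atTop :=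
        limsup_le_limsup (hDle.mono fun T hT => by simpa only [Pi.add_apply] using hT)
          (isCoboundedUnder_le_of_eventually_le atTop hDge)
          (isBoundedUnder_le_add hK.isBoundedUnder_le hPbdd)
    _ ≤ limsup (fun T : ℝ => E₀ * T⁻¹) atTop + limsup (timeMean P) atTop :=
        limsup_add_le hK.isBoundedUnder_ge hK.isBoundedUnder_le
          (isCoboundedUnder_le_of_eventually_le atTop hPge) hPbdd
    _ = meanPower f u := by
        rw [hK.limsup_eq, zero_add]
        rfl

end Discharge

end Literature.Analysis.FluidPDE

end
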